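import Summits.QuantumFields.YangMills.Theorems.UnitScaleTiltHistoryTailAlphaTopQuarter
import Summits.QuantumFields.YangMills.Theorems.LevelShiftBootstrapHistoryTailOfLocalStabilityInduction
import HarnessLib

/-!
# `UnitScaleTiltHistoryTailAlphaTopQuarterScaled` — [Balaban1985UV3] (71) AT A SCALED THRESHOLD: the datum-large-plaquette small factor `exp(−(c²∕4)·p(g_j)²)` for a plaquette
# that is large only at the fraction `c·θBal` of the (4)∕(7) window (`0 < c ≤ 1`; the (★1) piece; `pFun_mul` REUSED from ✓`…HistoryTailOfLocalStability`, not restated — of the χ-CLASH docket's owed fact (★), cell ym3-torus RECORD 17ds;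
# seat ym-ust-19936-w8 g17; helper `--supports stmt-QuantumFields-19936`)

WHY.  The annulus `A_k = {ε₁(k)∕max(B₃,1) ≤ |U(∂p′) − 1| < ε₁(k)}` of the (4)-window (where the registered (O‴χₛ) rows' χ-clash lives: `W_k ⊆ A_k` by
✓`PkgCoreRows.intWindowT3_subset_loPrintAC`) needs print's (71) small factor at the SCALED threshold `c·θBal`, `c = 1∕max(B₃,1)`.  Because print's profile is LINEAR in
`b₀` — `p(g) = b₀(1 + log g⁻¹)^{p₀}` (`B10.pFun`), `θBal = g·p(g)` (`T3UnitScaleTilt.θBal`) — the scaled statement is the landed one ✓`HistoryTailAlphaTopQuarter.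
quarter_pFun_sq_le_localAction` read at `(b₀, C68) ↦ (c·b₀, C68∕c)`: the (68)-regularity hypothesis is invariant (`(C68∕c)·θBal(c·b₀) = C68·θBal(b₀)`), the local-Stokes side
condition `hθ1` is invariant, the remainder side condition `hθ2` picks up the factor `c⁻²` (stated here as `… ≤ c²∕4`), and the conclusion reads `(c²∕4)·p(g_{K−j})² ≤ β_K·Σ_{q∈R₀}
(1 − Re tr U_j(h,W)(∂q))`.  No new analysis: three rescaling identities and one application.  PRICE OF RECORD (★★OWNER g37 WORD №143): the remainder side condition `hθ2`
is `c²`-STRONGER than the landed `≤ 1∕4`, so the coupling threshold `γ₁` below which it holds (cf. ✓`exists_gamma_quarter_regime` at `c = 1`) now DEPENDS ON `B₃` through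
`c = 1∕max(B₃,1)`; `hθ1` and the (68)-regularity input are invariant.
HONEST SCOPE.  [folklore] rescaling of a landed theorem; (71) itself is ✓ in tree at `c = 1`; nothing else of [Balaban1985UV3] is asserted; (★) (the fluctuation-integral assembly),
#22∕#23, (O‴χₛ), `HistoryTailL` (19936), EX are NOT proved; def-free; count-neutral helper.  Rung R3 bookkeeping; not d = 4, not a mass gap, not Clay; the Yang–Mills mass gap is
NOT proved.
References: T. Bałaban, Commun. Math. Phys. 102 (1985) 255–275 [Balaban1985UV3] ((7) p.257, (67)–(71) p.273).
-/

set_option autoImplicit false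

noncomputable section

open scoped BigOperators

namespace Summit.QuantumFields.YangMills.Theorems.HistoryTailAlphaTopQuarterScaled

open Literature.MathematicalPhysics.QuantumFieldTheory.Balaban1983to89
open T4Continuum BlockAveraging
open T3ContinuumYM3Torus T3UnitScaleTilt T3UnitLawDensityEML
open T3AlphaInputsAC
open B10Eq38TorusDomains (toFine plaqsIn)
open Summit.QuantumFields.YangMills.Theorems.HistoryTailAlphaTopQuarter (quarter_pFun_sq_le_localAction)
open Summit.QuantumFields.YangMills.Theorems.HistoryTailOfLocalStability (pFun_mul)
open Summit.QuantumFields.YangMills.Theorems.HistoryTailSmallFactorLocal (smallFactor_deterministic_loc)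
open B10Eq47AxialChi (shiftN)

/-! ## §1 Print's profile is linear in `b₀` -/

/-- `θBal(c·b₀) = c·θBal(b₀)` — the threshold `g_i·p(g_i)` is linear in `b₀`. [cite: Balaban1985UV3, (7) p.257] -/
theorem θBal_mul_b₀ (L : ℕ) (γ c b₀ p₀ : ℝ) (i : ℕ) : θBal L γ (c * b₀) p₀ i = c * θBal L γ b₀ p₀ i := by
  unfold θBal; rw [pFun_mul]; ring

variable {F : T3Family} {γ : ℝ} {D : AlphaDataT3 F γ}

/-- The multilevel (68)-regularity hypothesis is invariant under `(b₀, C68) ↦ (c·b₀, C68∕c)` for `c ≠ 0` (its windows are the products `C68·θBal(b₀)`).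
[cite: Balaban1985UV3, (68) p.273] -/
theorem regularity68Levels_rescale {b₀ p₀ C68 c : ℝ} (hc : c ≠ 0) (h68 : Regularity68Levels D b₀ p₀ C68) :
    Regularity68Levels D (c * b₀) p₀ (C68 / c) := by
  intro K j hh W hj hadm i hi s hs q hq
  have key := h68 K j hh W hj hadm i hi s hs q hq
  have e : C68 / c * θBal F.L γ (c * b₀) p₀ (K - i) = C68 * θBal F.L γ b₀ p₀ (K - i) := by
    rw [θBal_mul_b₀]; field_simp
  rw [e]; exact key

/-! ## §2 (71) at the scaled threshold `c·θBal` -/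

/-- **(71) FOR A DATUM PLAQUETTE LARGE AT THE SCALED THRESHOLD `c·θBal(K−j)`** (`0 < c ≤ 1`; `SU(2)`, `d = 3`): under the hypotheses of
✓`quarter_pFun_sq_le_localAction` with `hlarge` weakened to `c·θBal ≤ |W(∂p′) − 1|` and the remainder side condition strengthened by `c²`
(`540·435²·(C68·(5L)²∕4)⁴·θBal² ≤ c²∕4`), the minimiser's action localized under `p′` is at least `(c²∕4)·p(g_{K−j})²` in `β_K` units — the small factor
`exp(−(c²∕4)·p²)` of an ANNULUS plaquette.  Proof: the landed theorem at `(c·b₀, C68∕c)`. [cite: Balaban1985UV3, (67)-(71) p.273] -/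
theorem quarter_pFun_sq_le_localAction_scaled (hγ : 0 < γ) (hγ1 : γ ≤ 1) {b₀ : ℝ} (hb₀ : 0 ≤ b₀) (p₀ : ℝ) {C68 : ℝ} (hC68 : 0 ≤ C68)
    {c : ℝ} (hc : 0 < c)
    (h42 : Constraint42Top D) (h68 : Regularity68Levels D b₀ p₀ C68)
    {K j : ℕ} (hjK : j ≤ K) (h : D.Hist K j) (W : GaugeField (F.P K) j (Matrix.specialUnitaryGroup (Fin 2) ℂ)) (hadm : D.Adm K j h W)
    (p' : Plaq (F.P K) j)
    (hΩ : {x : Site (F.P K) 0 | ∀ ι, ∃ e : ℤ, |e| ≤ 8 * ((F.P K).L : ℤ) ^ j ∧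
      x ι = toFine j p'.src ι + (e : ZMod ((F.P K).sitesPerDir 0))} ⊆ D.Ω K j h j)
    (hlarge : c * θBal F.L γ b₀ p₀ (K - j) ≤ GaugeGroup.dist1 (GaugeField.plaqHol W p'))
    (hθ1 : ((((3 + 2) * F.L : ℕ) : ℝ) ^ 2 / 4) * (C68 * θBal F.L γ b₀ p₀ (K - j)) ≤ 1 / 10)
    (hθ2 : 540 * (435 ^ 2 * (C68 * (((3 + 2) * F.L : ℕ) : ℝ) ^ 2 / 4) ^ 4) * θBal F.L γ b₀ p₀ (K - j) ^ 2 ≤ c ^ 2 / 4) :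
    ∃ R₀ : Finset (Plaq (F.P K) 0),
      (∀ q ∈ R₀, ∀ ι, ∃ e : ℤ, |e| ≤ 3 * (((F.P K).L : ℤ) ^ j - 1) ∧
        q.src ι = toFine j p'.src ι + (e : ZMod ((F.P K).sitesPerDir 0))) ∧
      (c ^ 2 / 4 : ℝ) * B10.pFun b₀ p₀ (Real.sqrt (γ * ((F.L : ℝ)⁻¹) ^ (K - j))) ^ 2 ≤
        (F.scheme ℰp γ).β K * ∑ q ∈ R₀, (1 - reTr (GaugeField.plaqHol (D.Umin K j h W) q)) := by
  have hc0 : c ≠ 0 := hc.ne'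
  have hcb : 0 ≤ c * b₀ := mul_nonneg hc.le hb₀
  have hCc : 0 ≤ C68 / c := div_nonneg hC68 hc.le
  -- the hypotheses of the landed theorem at `(c·b₀, C68/c)`
  have hlarge' : θBal F.L γ (c * b₀) p₀ (K - j) ≤ GaugeGroup.dist1 (GaugeField.plaqHol W p') := by rwa [θBal_mul_b₀]
  have hθ1' : ((((3 + 2) * F.L : ℕ) : ℝ) ^ 2 / 4) * (C68 / c * θBal F.L γ (c * b₀) p₀ (K - j)) ≤ 1 / 10 := by
    rw [θBal_mul_b₀]
    have e : C68 / c * (c * θBal F.L γ b₀ p₀ (K - j)) = C68 * θBal F.L γ b₀ p₀ (K - j) := by field_simp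
    rw [e]; exact hθ1
  have hθ2' : 540 * (435 ^ 2 * (C68 / c * (((3 + 2) * F.L : ℕ) : ℝ) ^ 2 / 4) ^ 4) * θBal F.L γ (c * b₀) p₀ (K - j) ^ 2 ≤ 1 / 4 := by
    rw [θBal_mul_b₀]
    have e : 540 * (435 ^ 2 * (C68 / c * (((3 + 2) * F.L : ℕ) : ℝ) ^ 2 / 4) ^ 4) * (c * θBal F.L γ b₀ p₀ (K - j)) ^ 2
        = (540 * (435 ^ 2 * (C68 * (((3 + 2) * F.L : ℕ) : ℝ) ^ 2 / 4) ^ 4) * θBal F.L γ b₀ p₀ (K - j) ^ 2) / c ^ 2 := by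
      field_simp
    rw [e, div_le_iff₀ (by positivity)]
    calc 540 * (435 ^ 2 * (C68 * (((3 + 2) * F.L : ℕ) : ℝ) ^ 2 / 4) ^ 4) * θBal F.L γ b₀ p₀ (K - j) ^ 2 ≤ c ^ 2 / 4 := hθ2
      _ = 1 / 4 * c ^ 2 := by ring
  obtain ⟨R₀, hR₀, hq⟩ := quarter_pFun_sq_le_localAction hγ hγ1 hcb p₀ hCc h42 (regularity68Levels_rescale hc0 h68) hjK h W hadm p' hΩ
    hlarge' hθ1' hθ2'
  refine ⟨R₀, hR₀, ?_⟩
  rw [pFun_mul] at hq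
  calc (c ^ 2 / 4 : ℝ) * B10.pFun b₀ p₀ (Real.sqrt (γ * ((F.L : ℝ)⁻¹) ^ (K - j))) ^ 2
      = (1 / 4 : ℝ) * (c * B10.pFun b₀ p₀ (Real.sqrt (γ * ((F.L : ℝ)⁻¹) ^ (K - j)))) ^ 2 := by ring
    _ ≤ (F.scheme ℰp γ).β K * ∑ q ∈ R₀, (1 - reTr (GaugeField.plaqHol (D.Umin K j h W) q)) := hq

/-! ## §3 The generic core at the scaled threshold (any fine field and its `j`-fold average; the socket of the step-k assembly row) -/

/-- **THE DETERMINISTIC (69)–(71) CHAIN AT THE SCALED THRESHOLD `c·θBal(K−j)`**, for ANY fine field `U` and its `j`-fold block average as datum (no `AlphaDataT3`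
record): ✓`HistoryTailSmallFactorLocal.smallFactor_deterministic_loc` read at `b₀ ↦ c·b₀` — the regularity profile `a`, the weights `ε`, the regions `R` and the side conditions
`ha`∕`ht` are `b₀`-free, so only `hlarge` (now `c·θBal ≤ |Ū^{(j)}(∂p′) − 1|`) and the conclusion (`c²·p²` in place of `p²`) move.  This is the form the post-freeze step-k
assembly row (★3) sockets at the composite minimiser `ukAll X.Uk k`. [cite: Balaban1985UV3, (67)-(71) p.273] -/
theorem smallFactor_deterministic_loc_scaled (hγ : 0 < γ) (hγ1 : γ ≤ 1) {b₀ : ℝ} (hb₀ : 0 ≤ b₀) (p₀ : ℝ) {c : ℝ} (hc : 0 ≤ c) {K j : ℕ} (hjK : j ≤ K)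
    (p' : Plaq (F.P K) j) (U : GaugeField (F.P K) 0 (Matrix.specialUnitaryGroup (Fin 2) ℂ)) (a ε : ℕ → ℝ)
    (R : (s : ℕ) → Finset (Plaq (F.P K) s)) (hRj : R j = {p'})
    (ha : ∀ s, s < j → 0 ≤ a s)
    (ht : ∀ s, s < j → ((((3 + 2) * F.L : ℕ) : ℝ) ^ 2 / 4) * a s ≤ 1 / 10)
    (hε : ∀ s, 0 < ε s) {Pm : ℝ} (hprod : ∏ s ∈ Finset.range j, (1 + ε s) ≤ Pm)
    (hloc : ∀ s, s < j → ∀ p ∈ R (s + 1), ∀ cb : PBond (F.P K) (s + 1),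
      (cb = ⟨p.src, p.μ⟩ ∨ cb = ⟨p.src.shift p.μ, p.ν⟩ ∨ cb = ⟨p.src.shift p.ν, p.μ⟩ ∨ cb = ⟨p.src, p.ν⟩) →
        ∀ v : List (Letter (F.P K).d), v.length ≤ ((F.P K).d + 2) * (F.P K).L + 2 →
          ∀ (a' b' : Fin (F.P K).d) (h : a' < b'),
            dist1 (GaugeField.plaqHol (Averaging.iter (fun _ => BlockAveraging.blockAvg ℰp) s U)
              ⟨walkEnd (emb cb.src) v, a', b', h⟩) ≤ a s)
    (hR : ∀ s, s < j → ∀ p ∈ R (s + 1), ∀ (r : Fin (F.P K).d → Fin (F.P K).L), ∀ t ∈ Finset.range (F.P K).L,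
      ∀ s' ∈ Finset.range (F.P K).L,
        (⟨shiftN (shiftN (Site.blockSite p.src r) p.ν t) p.μ s', p.μ, p.ν, p.hμν⟩ : Plaq (F.P K) s) ∈ R s)
    (hlarge : c * θBal F.L γ b₀ p₀ (K - j) ≤
      dist1 (GaugeField.plaqHol (Averaging.iter (fun _ => BlockAveraging.blockAvg ℰp) j U) p')) :
    (c ^ 2 * B10.pFun b₀ p₀ (Real.sqrt (γ * ((F.L : ℝ)⁻¹) ^ (K - j))) ^ 2 -
        (F.scheme ℰp γ).β (K - j) *
          (∑ s ∈ Finset.range j, (∏ u ∈ Finset.Ico (s + 1) j, ((1 + ε u) * (F.L : ℝ))) *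
            ((R (s + 1)).card * ((1 + (ε s)⁻¹) * (435 * (((((3 + 2) * F.L : ℕ) : ℝ) ^ 2 / 4) * a s) ^ 2) ^ 2)))) / (2 * Pm) ≤
      (F.scheme ℰp γ).β K * ∑ q ∈ R 0, (1 - reTr (GaugeField.plaqHol U q)) := by
  have hcb : 0 ≤ c * b₀ := mul_nonneg hc hb₀
  have hlarge' : θBal F.L γ (c * b₀) p₀ (K - j) ≤
      dist1 (GaugeField.plaqHol (Averaging.iter (fun _ => BlockAveraging.blockAvg ℰp) j U) p') := by rwa [θBal_mul_b₀]
  have h := smallFactor_deterministic_loc F hγ hγ1 hcb p₀ hjK p' U a ε R hRj ha ht hε hprod hloc hR hlarge'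
  rw [pFun_mul] at h
  have e : (c * B10.pFun b₀ p₀ (Real.sqrt (γ * ((F.L : ℝ)⁻¹) ^ (K - j)))) ^ 2
      = c ^ 2 * B10.pFun b₀ p₀ (Real.sqrt (γ * ((F.L : ℝ)⁻¹) ^ (K - j))) ^ 2 := by ring
  rwa [e] at h

end Summit.QuantumFields.YangMills.Theorems.HistoryTailAlphaTopQuarterScaled

end
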